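import Summits.Ventures.LatticeQCDFlow.Scoring.SU2CoolingMap
import HarnessLib

/-!
# Fixed points of `SU(2)` cooling versus stationary points of the Wilson flow: cooling-stable configurations are flow-stationary

HONEST FRAMING: exact (Metropolis-corrected) sampling algorithms for lattice gauge theory;
figures of merit are autocorrelation/cost numbers at stated couplings and volumes; no
continuum-physics claim.

Venture `LatticeQCDFlow` (cell pub-lqcd), sub-topic `Scoring`; FANOUT row 16 (`su2-base`), whose two charge definitions
smooth the field in two ways — the Wilson FLOW (clover charge at `t_L`) and COOLING (α-rounded charge after `n_cool`
sweeps) — and whose acceptance test compares their integer roundings.  NEW WORK of the cell (placement rule), part 4 of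
the cooling packet: `Scoring/WilsonStapleSum` (`Ω_e = U_e R_e`, `plaquetteLoopSum_eq_mul_stapleSum`), `Scoring/SU2Cooling`
(`coolMat`, `Re tr (g R) ≤ 2√det R`, uniqueness of the maximiser) and `Scoring/SU2CoolingMap` (`su2Cool`), over the
Literature Wilson flow (`QuantumFieldTheory/WilsonFlow`: `wilsonFlowVF V e = −P(Ω_e(V)) V_e`, `suProj`,
`wilsonFlow_eq_self_of_wilsonFlowVF_eq_zero`).  Nothing is cited as a fact; no number.  Printed counterparts, NAMED ONLY:
Lüscher, JHEP 08 (2010) 071 §1 (the flow as the gradient flow of the Wilson action); Bonati–D'Elia, Phys. Rev. D 89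
(2014) 105005 (cooling versus gradient flow on topology).

## What is proved (`G = SU(2) = Matrix.specialUnitaryGroup (Fin 2) ℂ`, fundamental representation, torus `(ℤ/L)^d`)

* §1 quaternion algebra: `trace_sub_conjTranspose_of_isQuat`, `suProj_of_isQuat` (`P(W) = ½(W − Wᴴ)` on quaternions),
  `eq_smul_one_of_isQuat_of_conjTranspose_eq` (a Hermitian quaternion is a REAL scalar matrix),
  **`suProj_eq_zero_iff_of_isQuat`** (`P(W) = 0 ↔ Wᴴ = W`); `neg_mem_SU2`.
* §2 `su2_linkAction_fibre_le` (`S_e ≤ 4(d−1) + 2√det R_e` on the fibre — the value `S_e` takes at a link ANTI-aligned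
  with its staple sum); **`su2Cool_eq_self_iff`** (`cool_e U = U ↔ U_e R_e = √det R_e · 1`: cooling-fixed = aligned);
  `isQuat_plaquetteLoopSum`, `wilsonFlowVF_eq_zero_iff_suProj`, **`wilsonFlowVF_eq_zero_iff_aligned`**
  (`Z(U)_e = 0 ↔ U_e R_e = ±√det R_e · 1`: the stationary links of the flow are exactly the fibre minimiser and the
  fibre maximiser of `S_e`); hence **`wilsonFlow_eq_self_of_su2Cool_eq_self`** and
  `wilsonFlow_eq_self_of_isCoolingStep_self`: a configuration fixed by every cooling update — equivalently (`L ≥ 2`)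
  one that is an exact cooling step of itself at every link, i.e. stable under EVERY exact cooling implementation and
  schedule — is a stationary point of the Wilson flow, `V_t(U) = U` for all real `t`; on these configurations the
  flowed and the cooled charge of row 16 coincide trivially.

NOT CLAIMED: the converse (a flow-stationary configuration with an ANTI-aligned link is not cooling-stable: cooling that
link lowers `S_W` by `4√det R_e`, `Scoring/SU2CoolingMap.wilsonAction_sub_wilsonAction_su2Cool`); convergence of
iterated cooling or of the flow as `t → ∞`; that cooled and flowed charges agree away from common fixed points (the
row's empirical `≥ 95 %`, not a theorem); `SU(N ≥ 3)`; any number.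
-/

noncomputable section

open Matrix
open Literature.MathematicalPhysics.QuantumFieldTheory
open Literature.MathematicalPhysics.QuantumLattice (fundamentalRep fundamentalRep_apply continuous_fundamentalRep)
open Summit.Ventures.LatticeQCDFlow.TrivializingMaps (linkAction)
open Summit.Ventures.LatticeQCDFlow.Exactness (IsQuat)
open Summit.Ventures.LatticeQCDFlow.Exactness.IsQuat (normSq)

namespace Summit.Ventures.LatticeQCDFlow.Scoring

/-! ## §1 Quaternion algebra: `P(W) = 0` iff `W` is Hermitian -/

section Quat

variable {W : Matrix (Fin 2) (Fin 2) ℂ}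

/-- A quaternion `W = [[a, b], [−b̄, ā]]` has `tr (W − Wᴴ) = 0`. -/
theorem trace_sub_conjTranspose_of_isQuat (hW : IsQuat W) : (W - Wᴴ).trace = 0 := by
  rw [Matrix.trace_sub, Matrix.trace_conjTranspose, Matrix.trace_fin_two, hW.diag, Complex.star_def, map_add,
    Complex.conj_conj]
  ring

/-- Hence Lüscher's projection of a quaternion is just its anti-Hermitian part: `P(W) = ½ (W − Wᴴ)`. -/
theorem suProj_of_isQuat (hW : IsQuat W) : suProj W = (1 / 2 : ℂ) • (W - Wᴴ) := by
  rw [suProj, trace_sub_conjTranspose_of_isQuat hW, mul_zero, zero_smul, sub_zero]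

/-- A Hermitian quaternion is a REAL scalar matrix: `Wᴴ = W` forces `W = (Re a) · 1`. -/
theorem eq_smul_one_of_isQuat_of_conjTranspose_eq (hW : IsQuat W) (h : Wᴴ = W) :
    W = ((W 0 0).re : ℂ) • (1 : Matrix (Fin 2) (Fin 2) ℂ) := by
  have h00 : (starRingEnd ℂ) (W 0 0) = W 0 0 := by
    have := congrFun (congrFun h 0) 0
    rwa [conjTranspose_apply, Complex.star_def] at this
  have h01 : W 0 1 = 0 := by
    have h10 := congrFun (congrFun h 0) 1
    rw [conjTranspose_apply, Complex.star_def, hW.offdiag, map_neg, Complex.conj_conj] at h10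
    have : (2 : ℂ) * W 0 1 = 0 := by linear_combination -h10
    simpa using this
  have ha : W 0 0 = ((W 0 0).re : ℂ) := (Complex.conj_eq_iff_re.mp h00).symm
  ext i j
  fin_cases i <;> fin_cases j
  · simpa using ha
  · simp [h01]
  · simp [hW.offdiag, h01]
  · simp only [Fin.mk_one, Fin.isValue, Matrix.smul_apply, Matrix.one_apply_eq, smul_eq_mul, mul_one]
    rw [hW.diag]
    exact h00.trans ha

/-- **`P(W) = 0` iff `W` is Hermitian**, for a quaternion `W` (then `W` is a real multiple of `1`). -/
theorem suProj_eq_zero_iff_of_isQuat (hW : IsQuat W) : suProj W = 0 ↔ Wᴴ = W := by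
  refine ⟨fun h => ?_, suProj_eq_zero_of_conjTranspose_eq⟩
  rw [suProj_of_isQuat hW, smul_eq_zero] at h
  rcases h with h | h
  · norm_num at h
  · exact (sub_eq_zero.mp h).symm

/-- `−W ∈ SU(2)` for `W ∈ SU(2)` (even dimension). -/
theorem neg_mem_SU2 (hW : W ∈ specialUnitaryGroup (Fin 2) ℂ) : -W ∈ specialUnitaryGroup (Fin 2) ℂ := by
  rw [Matrix.mem_specialUnitaryGroup_iff] at hW ⊢
  refine ⟨?_, ?_⟩
  · rw [Matrix.mem_unitaryGroup_iff] at hW ⊢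
    rw [star_neg, neg_mul_neg, hW.1]
  · rw [Matrix.det_neg, hW.2, Fintype.card_fin]
    norm_num

end Quat

/-! ## §2 Cooling-fixed links, flow-stationary links, and the bridge -/

section Bridge

variable {d L : ℕ} [NeZero L]

/-- **The link action is bounded ABOVE on every fibre too**: `S_e(h ·_e U) ≤ 4(d−1) + 2 √det R_e(U)` (the bound is
the value `S_e` takes at a link anti-aligned with its staple sum, `U_e R_e = −√det R_e · 1`, when there is one). -/
theorem su2_linkAction_fibre_le (hL : 2 ≤ L) (U : GaugeConfig d L (specialUnitaryGroup (Fin 2) ℂ)) (x : Site d L)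
    (μ : Fin d) (h : specialUnitaryGroup (Fin 2) ℂ) :
    linkAction (fundamentalRep (Fin 2)) (x, μ) (Pi.mulSingle (x, μ) h * U) ≤
      4 * ((d - 1 : ℕ) : ℝ) + 2 * √(normSq (stapleSum (fundamentalRep (Fin 2)) U x μ)) := by
  rw [su2_linkAction_eq hL, stapleSum_mulSingle_self (fundamentalRep (Fin 2)) hL, mulSingle_mul_apply_self]
  have hle := re_trace_mul_le (neg_mem_SU2 (SetLike.coe_mem (h * U (x, μ)))) (isQuat_stapleSum U x μ)
  rw [Matrix.neg_mul, Matrix.trace_neg, Complex.neg_re] at hle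
  linarith

omit [NeZero L] in
/-- **Cooling-fixed at a link iff the link is ALIGNED with its staple sum**: `cool_e U = U ↔ U_e R_e = √det R_e · 1`
(both sides hold trivially when `R_e = 0`). -/
theorem su2Cool_eq_self_iff (U : GaugeConfig d L (specialUnitaryGroup (Fin 2) ℂ)) (x : Site d L) (μ : Fin d) :
    su2Cool U x μ = U ↔
      (U (x, μ) : Matrix (Fin 2) (Fin 2) ℂ) * stapleSum (fundamentalRep (Fin 2)) U x μ =
        ((√(normSq (stapleSum (fundamentalRep (Fin 2)) U x μ)) : ℝ) : ℂ) • (1 : Matrix (Fin 2) (Fin 2) ℂ) := by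
  have hq := isQuat_stapleSum U x μ
  by_cases h0 : stapleSum (fundamentalRep (Fin 2)) U x μ = 0
  · simp only [su2Cool_of_eq_zero h0, h0, Matrix.mul_zero, true_iff]
    simp [normSq]
  constructor
  · intro h
    rw [show ((U (x, μ) : specialUnitaryGroup (Fin 2) ℂ) : Matrix (Fin 2) (Fin 2) ℂ) =
        coolMat (stapleSum (fundamentalRep (Fin 2)) U x μ) by rw [← su2Cool_apply_self h0, h], coolMat_mul_self hq h0]
  · intro h
    have htr : ((U (x, μ) : Matrix (Fin 2) (Fin 2) ℂ) * stapleSum (fundamentalRep (Fin 2)) U x μ).trace.re =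
        2 * √(normSq (stapleSum (fundamentalRep (Fin 2)) U x μ)) := by
      rw [h, Matrix.trace_smul, Matrix.trace_one, Fintype.card_fin, smul_eq_mul, Complex.re_ofReal_mul]
      norm_num
      ring
    exact su2Cool_eq_self_of_coe_eq h0 (eq_coolMat_of_re_trace_eq (SetLike.coe_mem (U (x, μ))) hq h0 htr)

omit [NeZero L] in
/-- The matrix `Ω_e = U_e R_e` driving the flow of an `SU(2)` field is a quaternion. -/
theorem isQuat_plaquetteLoopSum (U : GaugeConfig d L (specialUnitaryGroup (Fin 2) ℂ)) (x : Site d L) (μ : Fin d) :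
    IsQuat (plaquetteLoopSum U x μ) := by
  rw [plaquetteLoopSum_eq_mul_stapleSum]
  exact (IsQuat.of_mem_specialUnitaryGroup (SetLike.coe_mem _)).mul (isQuat_stapleSum U x μ)

omit [NeZero L] in
/-- The Wilson-flow velocity of a link vanishes iff `P(Ω_e) = 0` (the link matrix is invertible). -/
theorem wilsonFlowVF_eq_zero_iff_suProj (U : GaugeConfig d L (specialUnitaryGroup (Fin 2) ℂ)) (x : Site d L)
    (μ : Fin d) : wilsonFlowVF U (x, μ) = 0 ↔ suProj (plaquetteLoopSum U x μ) = 0 := by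
  rw [wilsonFlowVF_apply, neg_mul, neg_eq_zero]
  refine ⟨fun h => ?_, fun h => by rw [h, Matrix.zero_mul]⟩
  have key := congrArg (· * ((U (x, μ) : specialUnitaryGroup (Fin 2) ℂ) : Matrix (Fin 2) (Fin 2) ℂ)ᴴ) h
  simpa only [Matrix.mul_assoc, WilsonFlow.mul_conjTranspose_self_SU, Matrix.mul_one, Matrix.zero_mul] using key

omit [NeZero L] in
/-- **Stationary links of the Wilson flow = links aligned OR anti-aligned with their staple sum**:
`Z(U)(x,μ) = 0 ↔ U_e R_e = +√det R_e · 1 ∨ U_e R_e = −√det R_e · 1` — the fibre-wise MINIMUM (the cooled link) or the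
fibre-wise MAXIMUM of the link action. -/
theorem wilsonFlowVF_eq_zero_iff_aligned (U : GaugeConfig d L (specialUnitaryGroup (Fin 2) ℂ)) (x : Site d L)
    (μ : Fin d) :
    wilsonFlowVF U (x, μ) = 0 ↔
      (U (x, μ) : Matrix (Fin 2) (Fin 2) ℂ) * stapleSum (fundamentalRep (Fin 2)) U x μ =
          ((√(normSq (stapleSum (fundamentalRep (Fin 2)) U x μ)) : ℝ) : ℂ) • (1 : Matrix (Fin 2) (Fin 2) ℂ) ∨
        (U (x, μ) : Matrix (Fin 2) (Fin 2) ℂ) * stapleSum (fundamentalRep (Fin 2)) U x μ =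
          -(((√(normSq (stapleSum (fundamentalRep (Fin 2)) U x μ)) : ℝ) : ℂ) • (1 : Matrix (Fin 2) (Fin 2) ℂ)) := by
  have hq := isQuat_plaquetteLoopSum U x μ
  rw [plaquetteLoopSum_eq_mul_stapleSum] at hq
  rw [wilsonFlowVF_eq_zero_iff_suProj, plaquetteLoopSum_eq_mul_stapleSum, suProj_eq_zero_iff_of_isQuat hq]
  set W := ((U (x, μ) : specialUnitaryGroup (Fin 2) ℂ) : Matrix (Fin 2) (Fin 2) ℂ) *
    stapleSum (fundamentalRep (Fin 2)) U x μ with hWdef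
  set k := √(normSq (stapleSum (fundamentalRep (Fin 2)) U x μ)) with hk
  constructor
  · intro h
    have hW := eq_smul_one_of_isQuat_of_conjTranspose_eq hq h
    -- the scalar is `± k`: take determinants
    have hdet : W.det = ((normSq (stapleSum (fundamentalRep (Fin 2)) U x μ) : ℝ) : ℂ) := by
      rw [hWdef, Matrix.det_mul, (Matrix.mem_specialUnitaryGroup_iff.mp (SetLike.coe_mem (U (x, μ)))).2, one_mul,
        (isQuat_stapleSum U x μ).det_eq]
    rw [hW, Matrix.det_smul, Matrix.det_one, mul_one, Fintype.card_fin, ← Complex.ofReal_pow,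
      Complex.ofReal_inj] at hdet
    have habs : |(W 0 0).re| = k := by
      rw [hk, ← hdet, Real.sqrt_sq_eq_abs]
    rcases (abs_eq (hk ▸ Real.sqrt_nonneg _)).mp habs with hr | hr
    · exact Or.inl (by rw [hW, hr])
    · exact Or.inr (by rw [hW, hr, Complex.ofReal_neg, neg_smul])
  · rintro (h | h)
    · rw [h, Matrix.conjTranspose_smul, Complex.star_def, Complex.conj_ofReal, Matrix.conjTranspose_one]
    · rw [h, Matrix.conjTranspose_neg, Matrix.conjTranspose_smul, Complex.star_def, Complex.conj_ofReal,
        Matrix.conjTranspose_one]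

omit [NeZero L] in
/-- **A cooling-fixed link is a stationary link of the Wilson flow.** -/
theorem wilsonFlowVF_eq_zero_of_su2Cool_eq_self {U : GaugeConfig d L (specialUnitaryGroup (Fin 2) ℂ)}
    {x : Site d L} {μ : Fin d} (h : su2Cool U x μ = U) : wilsonFlowVF U (x, μ) = 0 :=
  (wilsonFlowVF_eq_zero_iff_aligned U x μ).mpr (Or.inl ((su2Cool_eq_self_iff U x μ).mp h))

/-- **Cooling-stable `SU(2)` configurations are stationary points of the Wilson flow**: if no cooling update moves
`U` (every link is aligned with its staple sum — the fixed points of EVERY cooling schedule), then `V_t(U) = U` for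
all `t ∈ ℝ`.  (The converse fails exactly at configurations with an anti-aligned link,
`wilsonFlowVF_eq_zero_iff_aligned`: those are flow-stationary but cooling that link lowers the action.) -/
theorem wilsonFlow_eq_self_of_su2Cool_eq_self {U : GaugeConfig d L (specialUnitaryGroup (Fin 2) ℂ)}
    (h : ∀ (x : Site d L) (μ : Fin d), su2Cool U x μ = U) (t : ℝ) : wilsonFlow t U = U :=
  wilsonFlow_eq_self_of_wilsonFlowVF_eq_zero (fun e => wilsonFlowVF_eq_zero_of_su2Cool_eq_self (h e.1 e.2)) t

/-- The relational version: a configuration that is an exact cooling step of itself at every link (stable under every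
exact cooling implementation) is Wilson-flow stationary (`L ≥ 2`). -/
theorem wilsonFlow_eq_self_of_isCoolingStep_self (hL : 2 ≤ L) {U : GaugeConfig d L (specialUnitaryGroup (Fin 2) ℂ)}
    (h : ∀ (x : Site d L) (μ : Fin d), IsCoolingStep (fundamentalRep (Fin 2)) (x, μ) U U) (t : ℝ) :
    wilsonFlow t U = U := by
  refine wilsonFlow_eq_self_of_su2Cool_eq_self (fun x μ => ?_) t
  by_cases h0 : stapleSum (fundamentalRep (Fin 2)) U x μ = 0
  · exact su2Cool_of_eq_zero h0
  · exact ((h x μ).eq_su2Cool hL h0).symm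

end Bridge

end Summit.Ventures.LatticeQCDFlow.Scoring
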